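import Summits.BirchSwinnertonDyer.BirchSwinnertonDyer.Theorems.KimAtThreeDeepLowerLevelLoweringSums
import Summits.BirchSwinnertonDyer.BirchSwinnertonDyer.Theorems.KimAtThreeShallowEqDeepOffStratumNonAdditiveRows
import Summits.BirchSwinnertonDyer.Rank1Residual.Additive.KuriharaNumberModulusReduction
import HarnessLib

/-!
# Route `KimAtThreeKolyvagin` (rung W2), crux `DeepLowerAtThreeOffKatoStratum` (item 19679) / `DeepLowerAtThree`
# (19075): «Tamagawa divisibility of Kurihara numbers» via LEVEL LOWERING — part 3/3: the bridge to the tree's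
# Kurihara numbers and `∂`-invariants, and the by-name rows with `v₃(∏ c_ℓ) ≤ m` under a depth-`m` congruence

Cell `bsd-addord`, seat `bsd-addord-w2-c2` (gen 4, OWNER of `stmt-BirchSwinnertonDyer-19679`; assembles via
`Cruxes.DeepLowerAtThreeOffKatoStratum.Birth.DeepLowerAtThreeOffKatoStratum_of`; stub hands acc2 / acc3).
Write at a tower row of analytic rank `0`: `a = ∂⁽⁰⁾(δ̃)`, `d = ∂^{(∞)}_{deep}(δ̃)`, `s = ord₃ #Ш[3^∞]`,
`c = v₃(∏ c_ℓ)`. The crux at the row is `a ≤ s + d`; the LOWER half of `BSD₃` gives `a ≤ s + c`; so the crux ⟸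
«TamDiv-deep» `c ≤ d` (p426576), and GIVEN `BSD(E,3)` the crux ⟺ `c ≤ d` (acc2, p449980-style sockets). Until
now `c ≤ d` was a DISPLAYED binder with no road except `c = 0`.

THE ROAD (displayed hypothesis **(LL_m)**, «stabilised level-lowering congruence of depth `m`»): a natural
number `q ∣ N_E·p`, an element `u ∈ ℤ/p^m` and a `1`-periodic `φ : ℚ → ℤ/p^m`, Hecke at every prime `ℓ ∤ N_E p`
with eigenvalue `a_ℓ(E)` (`a_ℓ φ(x) = ∑_{j<ℓ} φ((x+j)/ℓ) + φ(ℓx)`), such that `[x]⁺_f ≡ u·(φ(x) − φ(qx))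
(mod p^m)` for every `x ∈ ℚ`. IN PRINT for `m = 1`, `p ∤ N_E` odd, `ρ̄_{E,p}` irreducible and `q` a
Tamagawa-`p` prime (`q ‖ N_E` split multiplicative with `p ∣ c_q = ord_q Δ`, so `ρ̄` is unramified at `q`;
at `p = 3` also `q ≠ 3` additive of type IV/IV* with `c_q = 3`, where `ρ̄|_{G_q} ≅ (1 *; 0 ω)` drops
conductor): Ribet 1990 Thm. 1.1 gives a newform `g` on `Γ₀(N_E/q)` with `ρ̄_g ≅ ρ̄_f`, `f ≡ g_α = g − g|V_q`
(mod 𝔭) as `q`-expansions (`α = a_q(f) = 1`), and mod-`p` MULTIPLICITY ONE of `ρ̄` in `J₀(N_E)[𝔪]`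
(Mazur–Ribet 1991 / Wiles 1995 Thm. 2.1 / Edixhoven 1997 §4; surveyed in Agashe–Ribet–Stein 2012 — at the
prime `q ‖ N_E` with `ρ̄` unramified at `q` it needs `ρ̄(Frob_q)` non-scalar, automatic unless `q ≡ 1 (mod p)`)
makes the `𝔪`-torsion plus eigen-symbol unique up to a scalar, so the integral plus symbols of `f` and of
`g_α` — the latter `x ↦ [x]⁺_g − [qx]⁺_g` up to the period unit (Vatsal 1999, canonical periods) — agree
mod `p` up to `u` (and when ALL `[x]⁺_f` vanish mod `p` the conclusion below is trivial anyway). Nothing of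
this is typed in the tree yet, so (LL_m) stays DISPLAYED here (never a fact). `m ≥ 2` (level lowering mod
`p^m`, Dahmen–Yazdani 2012 under `p^m ∣ ord_q Δ`) is rarer in print.

What is here (theorems only, no definition, no named fact, no `sorry`):
* §2 `kuriharaNumber_eq_zero_of_stabilisedCongruence` — (LL) at a square-free level `n` prime to `q` kills the
  tree's `kuriharaNumber f (p^k) n ψ` for EVERY choice of logarithms (part 2 applied to `χ_ℓ = log_ψ` extended
  by `0`); `kuriharaDivisibleAt_of_stabilisedCongruence` — (LL_m) for the newform `f` of `W` with `p`-integral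
  plus symbols ⟹ `KuriharaDivisibleAt W p f n m` for every `n` (at `n ∈ 𝒩_k(E,p)`, `k ≤ m`:
  `a_ℓ ≡ ℓ + 1 ≡ 2 (mod p^k)` and the congruence reduces mod `p^k`); hence `m ≤ kuriharaDivIndex`,
  `m ≤ ∂^{(i)}(δ̃)` for all `i`, `m ≤ ∂^{(∞)}(δ̃) ≤ ∂^{(∞)}_{deep}(δ̃)` (`le_kuriharaPartials_of_stabilisedCongruence`).
* §3 `tamagawa_le_kuriharaPartialInfty_of_stabilisedCongruence` — TamDiv∞ AND TamDiv-deep at every row with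
  `v_p(∏ c_ℓ) ≤ m` (the displayed binder of w2-c4's / acc2's / w2-c2 g2's sockets DISCHARGED under (LL_m));
  `deepLowerAtThree_row_of_missingLowerBoundAt_of_stabilisedCongruence` (19075 binders verbatim + period
  transfer + Miller's lower half + (LL_m)); `deepLowerOff_row_goodOrd_of_yanZhu_of_stabilisedCongruence`,
  `deepLowerOff_row_mult_of_skinner_of_stabilisedCongruence` (binders of 19679's registered stub
  `stub_nonAdditive` VERBATIM + good-ordinary `3` (Yan–Zhu 2026 4.15 `hYZ`, Wuthrich 2014 L20 `hW20`, `hmod`,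
  `hGZK`, Mazur Cor. 4.1 `hMaz`) / multiplicative `3` with (ram) (Skinner 2016 Thm. C `hSk`) + `v₃(∏ c_ℓ) ≤ m`
  + (LL_m)). The `m = 0` slice is w2-c2 g2's unit-Tamagawa row (p428588); `m = 1` is the new population.

NOT here: (LL_1) as a Literature fact (to be typed); rows with `v₃(∏ c_ℓ) ≥ 2` ((LL_2) or a second mechanism);
good supersingular `3` / mult. `3` without (ram) (no `BSD(E,3)` socket); additive-defect rows (acc3). HONEST
FRAMING: crux 19679 stays OPEN; BSD is not proved by any of this.

References: [Ota2018] Prop. 2.3 (1), Prop. 3.3; [Kim2022StructureSelmer] §1.5.1, Def. 2.13, Conj. 1.10, Rem. 6.2;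
[Kim2025RefinedTNC] §8.1.2; [Ribet1990] Thm. 1.1; [MazurRibet1991]; [Wiles1995] Thm. 2.1; [AgasheRibetStein2012];
[Vatsal1999]; [GreenbergVatsal2000] §3; [DahmenYazdani2012]; [YanZhu2024MainConjNonCM] 4.15; [Wuthrich2014] L. 20; [Skinner2016PacificMC] Thm. C; [Mazur1978] Cor. 4.1; [Miller2011LMS] Def. 1.1.
-/

set_option autoImplicit false
-- the Theorems namespace of a single-conjunct summit repeats the summit name by design (D-0017)
set_option linter.dupNamespace false

noncomputable section

open scoped BigOperators Classical MatrixGroups ModularForm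

namespace Summit.BirchSwinnertonDyer.BirchSwinnertonDyer.Theorems.KimAtThreeDeepLowerTamagawaLevelLowering

open Summit.BirchSwinnertonDyer.BirchSwinnertonDyer.Theorems.KimAtThreeDeepLowerLevelLoweringFibers
  Summit.BirchSwinnertonDyer.BirchSwinnertonDyer.Theorems.KimAtThreeDeepLowerLevelLoweringSums

/-! ### §2 The bridge: a stabilised level-lowering congruence kills every Kurihara number -/

section Bridge

open CongruenceSubgroup Literature.NumberTheory.EllipticCurves Literature.NumberTheory.EllipticCurves.ModularForms
open Literature.NumberTheory.DiophantineGeometry.Dioph (ratModP)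

/-- **A `q`-stabilised congruence kills the Kurihara number at a square-free level prime to `q`.** Let
`f ∈ S₂(Γ₀(N))`, `n` square-free, `q` prime to `n`, and suppose the level-`n` plus symbols of `f` reduce
mod `p^k` to `u·(φ(x) − φ(qx))` for a `1`-periodic `φ : ℚ → ℤ/p^k` that is Hecke with eigenvalue `2` at every
prime of `n` (the shape of «`f ≡ g_α mod p^k`, `g` of level prime to the primes of `n`, `a_ℓ(g) ≡ ℓ + 1 ≡ 2`»).
Then `δ_n(f) = kuriharaNumber f (p^k) n ψ = 0` for EVERY family of discrete logarithms `ψ`.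
[cite: Ota2018, Prop. 2.3 (1) and Prop. 3.3] [cite: Kurihara2014, §1.1 display (2)] -/
theorem kuriharaNumber_eq_zero_of_stabilisedCongruence {N : ℕ} (f : CuspForm (Gamma0 N) 2)
    (p k : ℕ) (n : ℕ) [NeZero n] (hsq : Squarefree n)
    (φ : ℚ → ZMod (p ^ k)) (u : ZMod (p ^ k)) (q : ℕ) (hq : q.Coprime n)
    (hper : ∀ x, φ (x + 1) = φ x)
    (hH : ∀ ℓ ∈ n.primeFactors, ∀ x : ℚ, 2 * φ x = (∑ j : Fin ℓ, φ ((x + j) / ℓ)) + φ (ℓ * x))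
    (hC : ∀ a : (ZMod n)ˣ, ratModP (p ^ k) (ratPlusSymbol f ((((a : ZMod n).val : ℚ)) / n)) =
        u * (φ (((a : ZMod n).val : ℚ) / n) - φ ((q : ℚ) * (a : ZMod n).val / n)))
    (ψ : (ℓ : ℕ) → (ZMod ℓ)ˣ →* Multiplicative (ZMod (p ^ k))) :
    kuriharaNumber f (p ^ k) n ψ = 0 := by
  classical
  -- the logarithms as `ℓ`-periodic functions on `ℕ`, `0` off the units
  set χ : ℕ → ℕ → ZMod (p ^ k) := fun ℓ a =>
    if h : IsUnit (a : ZMod ℓ) then Multiplicative.toAdd (ψ ℓ h.unit) else 0 with hχdef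
  have hχ : ∀ ℓ ∈ n.primeFactors, ∀ a, χ ℓ (a + ℓ) = χ ℓ a := by
    intro ℓ _ a
    simp only [hχdef, Nat.cast_add, ZMod.natCast_self, add_zero]
  have hunit_eq : ∀ (ℓ : ℕ) (a : ℕ) (ha : IsUnit (a : ZMod ℓ)),
      χ ℓ a = Multiplicative.toAdd (ψ ℓ ha.unit) := fun ℓ a ha => by
    simp only [hχdef, dif_pos ha]
  have hlog : ∀ ℓ ∈ n.primeFactors, ∀ a b : ℕ, a.Coprime ℓ → b.Coprime ℓ →
      χ ℓ (a * b) = χ ℓ a + χ ℓ b := by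
    intro ℓ _ a b ha hb
    have hau : IsUnit (a : ZMod ℓ) := (ZMod.isUnit_iff_coprime a ℓ).mpr ha
    have hbu : IsUnit (b : ZMod ℓ) := (ZMod.isUnit_iff_coprime b ℓ).mpr hb
    have habu : IsUnit ((a * b : ℕ) : ZMod ℓ) := by
      rw [Nat.cast_mul]
      exact hau.mul hbu
    rw [hunit_eq ℓ _ habu, hunit_eq ℓ _ hau, hunit_eq ℓ _ hbu, ← toAdd_mul, ← map_mul]
    congr 2
    ext
    push_cast [IsUnit.unit_spec]
    rfl
  -- the weight of the tree's `kuriharaNumber` is `∏_{ℓ ∣ n} χ_ℓ(ã)`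
  have hw : ∀ a : (ZMod n)ˣ,
      (∏ ℓ ∈ n.primeFactors.attach, Multiplicative.toAdd
        (ψ ℓ.1 (ZMod.unitsMap (Nat.dvd_of_mem_primeFactors ℓ.2) a))) =
        ∏ ℓ ∈ n.primeFactors, χ ℓ (a : ZMod n).val := by
    intro a
    rw [← Finset.prod_attach n.primeFactors (fun ℓ => χ ℓ (a : ZMod n).val)]
    refine Finset.prod_congr rfl fun ℓ _ => ?_
    have hcoe : (((a : ZMod n).val : ℕ) : ZMod ℓ.1) =
        ((ZMod.unitsMap (Nat.dvd_of_mem_primeFactors ℓ.2) a : (ZMod ℓ.1)ˣ) : ZMod ℓ.1) := by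
      haveI : NeZero ℓ.1 := ⟨(Nat.prime_of_mem_primeFactors ℓ.2).ne_zero⟩
      rw [ZMod.unitsMap_def, Units.coe_map, MonoidHom.coe_coe, ZMod.castHom_apply, ZMod.cast_eq_val]
    have hu : IsUnit ((((a : ZMod n).val : ℕ)) : ZMod ℓ.1) := by
      rw [hcoe]
      exact Units.isUnit _
    rw [hunit_eq ℓ.1 _ hu]
    congr 2
    ext
    rw [IsUnit.unit_spec, hcoe]
  rw [kuriharaNumber_def]
  simp_rw [hw, hC]
  have h0 := kuriharaSum_stabilised_eq_zero (R := ZMod (p ^ k)) (χ := χ) hper n hsq hH hχ hlog hq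
  calc ∑ a : (ZMod n)ˣ, u * (φ (((a : ZMod n).val : ℚ) / n) - φ ((q : ℚ) * (a : ZMod n).val / n)) *
        ∏ ℓ ∈ n.primeFactors, χ ℓ (a : ZMod n).val
      = u * ∑ a : (ZMod n)ˣ, (φ (((a : ZMod n).val : ℚ) / n) - φ ((q : ℚ) * (a : ZMod n).val / n)) *
        ∏ ℓ ∈ n.primeFactors, χ ℓ (a : ZMod n).val := by
          rw [Finset.mul_sum]
          exact Finset.sum_congr rfl fun a _ => by ring
    _ = 0 := by rw [h0, mul_zero]

variable (W : WeierstrassCurve ℚ) [W.IsGloballyMinimal]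

/-- **The displayed hypothesis (LL_m) and its consequence on Kurihara numbers.** Fix a prime `p`, a depth
`m`, and the newform `f` of `W` with `p`-integral plus symbols. SUPPOSE («stabilised level-lowering congruence
mod `p^m`», displayed — for `m = 1` and `q` a Tamagawa-`p` prime this is Ribet's level lowering read on
integral modular symbols with mod-`p` multiplicity one): there are `q ∣ N_E·p`, a unit-or-not `u ∈ ℤ/p^m` and
a `1`-periodic `φ : ℚ → ℤ/p^m`, Hecke at every prime `ℓ ∤ N_E p` with eigenvalue `a_ℓ(E) mod p^m`, with
`[x]⁺_f ≡ u·(φ(x) − φ(qx)) (mod p^m)` for all `x ∈ ℚ`. THEN every Kurihara number of `f` at every level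
`n ∈ 𝒩_k(E,p)`, `k ≤ m`, vanishes mod `p^k` — i.e. `δ̃_n ∈ p^m ℤ_p/I_nℤ_p` for all `n ∈ 𝒩_1`
(`KuriharaDivisibleAt W p f n m`): at a Kolyvagin prime of level `k`, `a_ℓ ≡ ℓ + 1 ≡ 2 (mod p^k)`.
[cite: Ota2018, Prop. 2.3 (1) and Prop. 3.3] [cite: Kim2022StructureSelmer, §1.5.1 (PDF p. 7), Def. 2.13]
[cite: Kim2025RefinedTNC, §8.1.2 (20787.e1: "δ̃_n vanishes mod 3 for every n ∈ 𝒩₁")] -/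
theorem kuriharaDivisibleAt_of_stabilisedCongruence (p m : ℕ) [Fact p.Prime] {N : ℕ}
    (f : CuspForm (Gamma0 N) 2) (hint : ∀ r : ℚ, ¬ p ∣ (ratPlusSymbol f r).den)
    (q : ℕ) (hq : q ∣ W.conductorNorm ℤ * p) (u : ZMod (p ^ m)) (φ : ℚ → ZMod (p ^ m))
    (hper : ∀ x, φ (x + 1) = φ x)
    (hφH : ∀ ℓ : ℕ, ℓ.Prime → ¬ ℓ ∣ W.conductorNorm ℤ * p → ∀ x : ℚ,
      (W.frobeniusTrace ℓ : ZMod (p ^ m)) * φ x = (∑ j : Fin ℓ, φ ((x + j) / ℓ)) + φ (ℓ * x))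
    (hC : ∀ x : ℚ, ratModP (p ^ m) (ratPlusSymbol f x) = u * (φ x - φ (q * x))) (n : ℕ) :
    KuriharaDivisibleAt W p f n m := by
  intro k hkm hkn ψ _
  haveI : NeZero n := ⟨hkn.ne_zero⟩
  -- reduce the congruence and the symbol to level `k`
  set π : ZMod (p ^ m) →+* ZMod (p ^ k) := ZMod.castHom (pow_dvd_pow p hkm) (ZMod (p ^ k)) with hπ
  refine kuriharaNumber_eq_zero_of_stabilisedCongruence f p k n hkn.squarefree (fun x => π (φ x)) (π u) q
    ?_ (fun x => by simp only [hper]) ?_ ?_ ψ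
  · -- `q` is prime to every Kolyvagin level
    refine Nat.coprime_of_dvd fun ℓ hℓ hℓq hℓn => ?_
    exact (hkn.isKolyvaginPrime hℓ hℓn).not_dvd (dvd_trans hℓq hq)
  · -- Hecke with eigenvalue `2 = a_ℓ` at the Kolyvagin primes of level `k`
    intro ℓ hℓ x
    have hK := hkn.2 ℓ hℓ
    have h2 : (π (W.frobeniusTrace ℓ : ZMod (p ^ m))) = 2 := by
      rw [map_intCast]
      exact (Kato.isKolyvaginPrime_iff_zmod.mp hK).2.2.2
    have := congrArg π (hφH ℓ hK.prime hK.not_dvd x)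
    rw [map_mul, h2, map_add, map_sum] at this
    exact this
  · intro a
    rw [← Summit.BirchSwinnertonDyer.Rank1Residual.Additive.KuriharaReduction.castHom_ratModP_pow p hkm
      (hint _), ← hπ, hC, map_mul, map_sub, mul_div_assoc]

/-- **(LL_m) ⟹ `p^m` divides every Kurihara number: `m ≤ kuriharaDivIndex W p f n` for every `n`.**
[cite: Kim2022StructureSelmer, Def. 2.13 (PDF p. 14)] -/
theorem le_kuriharaDivIndex_of_stabilisedCongruence (p m : ℕ) [Fact p.Prime] {N : ℕ}
    (f : CuspForm (Gamma0 N) 2) (hint : ∀ r : ℚ, ¬ p ∣ (ratPlusSymbol f r).den)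
    (q : ℕ) (hq : q ∣ W.conductorNorm ℤ * p) (u : ZMod (p ^ m)) (φ : ℚ → ZMod (p ^ m))
    (hper : ∀ x, φ (x + 1) = φ x)
    (hφH : ∀ ℓ : ℕ, ℓ.Prime → ¬ ℓ ∣ W.conductorNorm ℤ * p → ∀ x : ℚ,
      (W.frobeniusTrace ℓ : ZMod (p ^ m)) * φ x = (∑ j : Fin ℓ, φ ((x + j) / ℓ)) + φ (ℓ * x))
    (hC : ∀ x : ℚ, ratModP (p ^ m) (ratPlusSymbol f x) = u * (φ x - φ (q * x))) (n : ℕ) :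
    (m : ℕ∞) ≤ kuriharaDivIndex W p f n :=
  le_kuriharaDivIndex_of_divisibleAt W p f
    (kuriharaDivisibleAt_of_stabilisedCongruence W p m f hint q hq u φ hper hφH hC n)

/-- **(LL_m) ⟹ `∂^{(i)}(δ̃) ≥ m` for every `i`, `∂^{(∞)}(δ̃) ≥ m` (all levels) and `∂^{(∞)}_{deep}(δ̃) ≥ m`.**
So a stabilised level-lowering congruence of depth `m` IS «Tamagawa divisibility of the Kurihara numbers»
at exponent `m` — at all levels (TamDiv∞) and a fortiori at deep levels (TamDiv-deep). [cite: Kim2022StructureSelmer, §1.5.1 (PDF p. 7), Conj. 1.10 (PDF p. 8)]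
[cite: MazurRubin2004, Def. 5.2.11] -/
theorem le_kuriharaPartials_of_stabilisedCongruence (p m : ℕ) [Fact p.Prime] {N : ℕ}
    (f : CuspForm (Gamma0 N) 2) (hint : ∀ r : ℚ, ¬ p ∣ (ratPlusSymbol f r).den)
    (q : ℕ) (hq : q ∣ W.conductorNorm ℤ * p) (u : ZMod (p ^ m)) (φ : ℚ → ZMod (p ^ m))
    (hper : ∀ x, φ (x + 1) = φ x)
    (hφH : ∀ ℓ : ℕ, ℓ.Prime → ¬ ℓ ∣ W.conductorNorm ℤ * p → ∀ x : ℚ,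
      (W.frobeniusTrace ℓ : ZMod (p ^ m)) * φ x = (∑ j : Fin ℓ, φ ((x + j) / ℓ)) + φ (ℓ * x))
    (hC : ∀ x : ℚ, ratModP (p ^ m) (ratPlusSymbol f x) = u * (φ x - φ (q * x))) :
    (∀ i : ℕ, (m : ℕ∞) ≤ kuriharaPartial W p f i) ∧ (m : ℕ∞) ≤ kuriharaPartialInfty W p f ∧
      (m : ℕ∞) ≤ kuriharaPartialDeepInfty W p f := by
  have hi : ∀ i : ℕ, (m : ℕ∞) ≤ kuriharaPartial W p f i := fun i =>
    le_iInf fun n => le_iInf fun _ => le_iInf fun _ =>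
      le_kuriharaDivIndex_of_stabilisedCongruence W p m f hint q hq u φ hper hφH hC n
  have hinf : (m : ℕ∞) ≤ kuriharaPartialInfty W p f := le_iInf hi
  exact ⟨hi, hinf, hinf.trans (kuriharaPartialInfty_le_kuriharaPartialDeepInfty W p f)⟩

end Bridge

/-! ### §3 Crux `DeepLowerAtThreeOffKatoStratum` (19679) / `DeepLowerAtThree` (19075) on rows with
`v₃(∏ c_ℓ) ≤ m` under (LL_m): the Tamagawa-divisibility binder of the by-name rows DISCHARGED -/

section Rows

open Literature.NumberTheory.DiophantineGeometry.Dioph (ratModP)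
open CongruenceSubgroup WeierstrassCurve Literature.NumberTheory.EllipticCurves
  Literature.NumberTheory.EllipticCurves.ModularForms
  Literature.NumberTheory.EllipticCurves.Rank1Residual
  Literature.NumberTheory.EllipticCurves.Rank1Residual.Typed
  Summit.BirchSwinnertonDyer.Rank1Residual
  Summit.BirchSwinnertonDyer.BirchSwinnertonDyer.Theorems.KimAtThreeDeepLowerSmallDefect
  Summit.BirchSwinnertonDyer.BirchSwinnertonDyer.Theorems.KimAtThreeDeepLowerNonAdditiveRows
  Summit.BirchSwinnertonDyer.BirchSwinnertonDyer.Theorems.KimAtThreeShallowEqDeepOffStratumNonAdditiveRows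

/-- `p`-integrality of the plus symbols in the crux's form (`[r]⁺ ≠ 0 → 0 ≤ v_p [r]⁺`) gives `p ∤ den [r]⁺`.
[folklore] -/
theorem not_dvd_den_of_padicValRat_nonneg (p : ℕ) [Fact p.Prime] {N : ℕ} (f : CuspForm (Gamma0 N) 2)
    (hint : ∀ r : ℚ, ratPlusSymbol f r ≠ 0 → 0 ≤ padicValRat p (ratPlusSymbol f r)) (r : ℚ) :
    ¬ p ∣ (ratPlusSymbol f r).den := by
  have hp : p.Prime := Fact.out
  by_cases h0 : ratPlusSymbol f r = 0
  · rw [h0, Rat.den_zero]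
    exact hp.not_dvd_one
  · intro hd
    have h := hint r h0
    set x := ratPlusSymbol f r with hx
    have hnum : ¬ (p : ℤ) ∣ x.num := fun hn => by
      have h1 : p ∣ x.num.natAbs := Int.natCast_dvd.mp hn
      have := Nat.dvd_gcd h1 hd
      rw [x.reduced] at this
      exact hp.one_lt.ne' (Nat.dvd_one.mp this)
    have hv : padicValRat p x = padicValInt p x.num - padicValNat p x.den := rfl
    rw [hv, padicValInt.eq_zero_of_not_dvd hnum] at h
    have h1 := one_le_padicValNat_of_dvd x.den_ne_zero hd
    omega

variable (W : WeierstrassCurve ℚ) [W.IsElliptic] [W.IsGloballyMinimal]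

omit [W.IsElliptic] in
/-- **TamDiv at exponent `m` from (LL_m)** — the displayed «Tamagawa divisibility» binders of the cell's
sockets, all-levels (`v_p(∏ c_ℓ) ≤ ∂^{(∞)}(δ̃)`, w2-c4's TamDiv∞) and deep (`≤ ∂^{(∞)}_{deep}(δ̃)`, this seat's
TamDiv-deep), DISCHARGED on every row with `v_p(∏ c_ℓ) ≤ m` by a stabilised level-lowering congruence of
depth `m` for the newform `f` (crux integrality binder verbatim). [cite: Kim2022StructureSelmer, Conj. 1.10 (PDF p. 8)]
[cite: Kim2025RefinedTNC, §8.1.2] -/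
theorem tamagawa_le_kuriharaPartialInfty_of_stabilisedCongruence (p m : ℕ) [Fact p.Prime] {N : ℕ}
    (f : CuspForm (Gamma0 N) 2)
    (hint : ∀ r : ℚ, ratPlusSymbol f r ≠ 0 → 0 ≤ padicValRat p (ratPlusSymbol f r))
    (hv : padicValNat p W.tamagawaProduct ≤ m)
    (q : ℕ) (hq : q ∣ W.conductorNorm ℤ * p) (u : ZMod (p ^ m)) (φ : ℚ → ZMod (p ^ m))
    (hper : ∀ x, φ (x + 1) = φ x)
    (hφH : ∀ ℓ : ℕ, ℓ.Prime → ¬ ℓ ∣ W.conductorNorm ℤ * p → ∀ x : ℚ,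
      (W.frobeniusTrace ℓ : ZMod (p ^ m)) * φ x = (∑ j : Fin ℓ, φ ((x + j) / ℓ)) + φ (ℓ * x))
    (hC : ∀ x : ℚ, ratModP (p ^ m) (ratPlusSymbol f x) = u * (φ x - φ (q * x))) :
    ((padicValNat p W.tamagawaProduct : ℕ) : ℕ∞) ≤ kuriharaPartialInfty W p f ∧
      ((padicValNat p W.tamagawaProduct : ℕ) : ℕ∞) ≤ kuriharaPartialDeepInfty W p f := by
  have h := le_kuriharaPartials_of_stabilisedCongruence W p m f
    (not_dvd_den_of_padicValRat_nonneg p f hint) q hq u φ hper hφH hC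
  have hv' : ((padicValNat p W.tamagawaProduct : ℕ) : ℕ∞) ≤ (m : ℕ∞) := Nat.cast_le.mpr hv
  exact ⟨hv'.trans h.2.1, hv'.trans h.2.2⟩

/-- **Crux 19075 at a row from the lower half of `BSD₃` and (LL_m)** — crux binders verbatim, the `3`-adic
period transfer, Miller's `MissingLowerBoundAt W 3`, `v₃(∏ c_ℓ) ≤ m` and a stabilised level-lowering
congruence of depth `m`: the «Tamagawa divisibility» binder of p426576's
`deepLowerAtThree_row_of_missingLowerBoundAt_of_tamagawa_le_deepInfty` DISCHARGED. [cite: Miller2011LMS, Def. 1.1]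
[cite: Kim2022StructureSelmer, Conj. 1.10 (PDF p. 8)] [cite: Kim2025RefinedTNC, §8.1.2] -/
theorem deepLowerAtThree_row_of_missingLowerBoundAt_of_stabilisedCongruence
    (hGZK : rank_eq_analyticRank_of_analyticRank_le_one) :
    ∀ (W : WeierstrassCurve ℚ) [W.IsElliptic] [W.IsGloballyMinimal],
      (∀ n : ℕ, W.HasSurjectiveModNGaloisRep (3 ^ n : ℕ)) →
      Finite W.sha →
      ∀ {N : ℕ} [NeZero N] (f : CuspForm (Gamma0 N) 2), IsNewformOf W f →
      (∀ r : ℚ, ratPlusSymbol f r ≠ 0 → 0 ≤ padicValRat 3 (ratPlusSymbol f r)) →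
      kuriharaVanishingOrder W 3 f = 0 →
      (∃ u : ℚ, ‖(u : ℚ_[3])‖ = 1 ∧ W.realPeriodRat = u * plusPeriod f) →
      MissingLowerBoundAt W 3 →
      ∀ m : ℕ, padicValNat 3 W.tamagawaProduct ≤ m →
      ∀ (q : ℕ), q ∣ W.conductorNorm ℤ * 3 → ∀ (u : ZMod (3 ^ m)) (φ : ℚ → ZMod (3 ^ m)),
        (∀ x, φ (x + 1) = φ x) →
        (∀ ℓ : ℕ, ℓ.Prime → ¬ ℓ ∣ W.conductorNorm ℤ * 3 → ∀ x : ℚ,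
          (W.frobeniusTrace ℓ : ZMod (3 ^ m)) * φ x = (∑ j : Fin ℓ, φ ((x + j) / ℓ)) + φ (ℓ * x)) →
        (∀ x : ℚ, ratModP (3 ^ m) (ratPlusSymbol f x) = u * (φ x - φ (q * x))) →
        ∃ d : ℕ, kuriharaPartialDeepInfty W 3 f = d ∧
          kuriharaPartial W 3 f 0 ≤
            ((padicValNat 3 (Nat.card (AddCommGroup.primaryComponent W.sha 3)) + d : ℕ) : ℕ∞) := by
  intro W _ _ htow hfin N _ f hf hint hord hper hlow m hv q hq u φ hperφ hφH hC
  haveI : Fact (Nat.Prime 3) := ⟨Nat.prime_three⟩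
  exact deepLowerAtThree_row_of_missingLowerBoundAt_of_tamagawa_le_deepInfty hGZK W htow hfin f hf hint
    hord hper hlow (tamagawa_le_kuriharaPartialInfty_of_stabilisedCongruence W 3 m f hint hv q hq u φ
      hperφ hφH hC).2

/-- **Crux 19679 `DeepLowerAtThreeOffKatoStratum` on the GOOD-ORDINARY tower rows with `v₃(∏ c_ℓ) ≤ m` and
(LL_m)** — binders of the registered stub `stub_nonAdditive` VERBATIM, then: good ordinary reduction at `3`,
`v₃(∏ c_ℓ) ≤ m`, and the congruence data `(q, u, φ)`; named facts Yan–Zhu 2026 Thm. 4.15 (`hYZ`), Wuthrich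
2014 Lemma 20 (`hW20`), modularity (`hmod`), GZK (`hGZK`), Mazur 1978 Cor. 4.1 (`hMaz`, the period transfer
for the optimal datum, w2-c4's `periodTransfer_three_of_optimal_of_not_addv`). The case `m = 0` is w2-c2 g2's
unit-Tamagawa row; `m = 1` with `q` a Tamagawa-`3` prime is the NEW population (exactly one `3` in `∏ c_ℓ`).
[cite: YanZhu2024MainConjNonCM, Thm. 4.15 (§4.6)] [cite: Wuthrich2014, Lemma 20 (p. 399)] [cite: Mazur1978, Cor. 4.1]
[cite: Kim2025RefinedTNC, §8.1.2] -/
theorem deepLowerOff_row_goodOrd_of_yanZhu_of_stabilisedCongruence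
    (hYZ : YanZhu2026.thm415_padicValRat_bsd_rank_le_one)
    (hW20 : Wuthrich2014.lemma20_surjective_threeAdic_of_semistable)
    (hmod : hasEntireLFunction_rat) (hGZK : rank_eq_analyticRank_of_analyticRank_le_one)
    (hMaz : mazur_not_dvd_maninConstant_of_odd) :
    ∀ (W₀ : WeierstrassCurve ℚ) [W₀.IsElliptic] [W₀.IsGloballyMinimal],
      (∀ n : ℕ, W₀.HasSurjectiveModNGaloisRep (3 ^ n : ℕ)) → Finite W₀.sha →
      ∀ {N : ℕ} [NeZero N], N = W₀.conductorNorm ℤ →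
      ∀ (D₀ : ModularParametrizationData W₀ N),
        (∀ z ∈ D₀.L.lattice, ∃ w ∈ periodLattice D₀.f, z = D₀.c * w) →
        (∀ (W₂ : WeierstrassCurve ℚ) [W₂.IsElliptic] (D₂ : ModularParametrizationData W₂ N),
          D₂.f = D₀.f → D₀.modularDegree ≤ D₂.modularDegree) →
        (∀ r : ℚ, ratPlusSymbol D₀.f r ≠ 0 → 0 ≤ padicValRat 3 (ratPlusSymbol D₀.f r)) →
        kuriharaVanishingOrder W₀ 3 D₀.f = 0 →
        ¬ (haveI : Fact (Nat.Prime 3) := ⟨Nat.prime_three⟩; Addv W₀ 3) →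
        W₀.HasGoodReductionAtPrime 3 → ¬ (3 : ℤ) ∣ W₀.frobeniusTrace 3 →
        ∀ m : ℕ, padicValNat 3 W₀.tamagawaProduct ≤ m →
        ∀ (q : ℕ), q ∣ W₀.conductorNorm ℤ * 3 → ∀ (u : ZMod (3 ^ m)) (φ : ℚ → ZMod (3 ^ m)),
          (∀ x, φ (x + 1) = φ x) →
          (∀ ℓ : ℕ, ℓ.Prime → ¬ ℓ ∣ W₀.conductorNorm ℤ * 3 → ∀ x : ℚ,
            (W₀.frobeniusTrace ℓ : ZMod (3 ^ m)) * φ x = (∑ j : Fin ℓ, φ ((x + j) / ℓ)) + φ (ℓ * x)) →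
          (∀ x : ℚ, ratModP (3 ^ m) (ratPlusSymbol D₀.f x) = u * (φ x - φ (q * x))) →
        ∃ d : ℕ, kuriharaPartialDeepInfty W₀ 3 D₀.f = d ∧
          kuriharaPartial W₀ 3 D₀.f 0 ≤
            ((padicValNat 3 (Nat.card (AddCommGroup.primaryComponent W₀.sha 3)) + d : ℕ) : ℕ∞) := by
  intro W₀ _ _ htow hfin N _ hN D₀ hopt _ hint hord hna hgood hord3 m hv q hq u φ hperφ hφH hC
  haveI : Fact (Nat.Prime 3) := ⟨Nat.prime_three⟩
  exact deepLowerAtThree_row_goodOrd_of_yanZhu_of_tamagawa_le_deepInfty hYZ hW20 hmod hGZK W₀ htow hfin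
    D₀.f D₀.isNewformOf hint hord hgood hord3
    (periodTransfer_three_of_optimal_of_not_addv W₀ hMaz hN D₀ hopt hna)
    (tamagawa_le_kuriharaPartialInfty_of_stabilisedCongruence W₀ 3 m D₀.f hint hv q hq u φ hperφ hφH hC).2

/-- **Crux 19679 on the MULTIPLICATIVE tower rows with Skinner's (ram) witness, `v₃(∏ c_ℓ) ≤ m` and (LL_m)**
— stub binders verbatim, then: multiplicative reduction at `3`, `Ram W₀ 3`, `v₃(∏ c_ℓ) ≤ m`, the congruence
data; named facts Skinner 2016 Thm. C (`hSk`), `hmod`, `hGZK`, `hMaz`. Here `q = 3` itself is admissible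
(split multiplicative `3` with `3 ∣ ord₃Δ`: ρ̄ finite at `3`). [cite: Skinner2016PacificMC, Thm. C (§1)]
[cite: Mazur1978, Cor. 4.1] [cite: Kim2025RefinedTNC, §8.1.2] -/
theorem deepLowerOff_row_mult_of_skinner_of_stabilisedCongruence
    (hSk : Skinner2016.thmC_padicValRat_bsd_rank_zero)
    (hmod : hasEntireLFunction_rat) (hGZK : rank_eq_analyticRank_of_analyticRank_le_one)
    (hMaz : mazur_not_dvd_maninConstant_of_odd) :
    ∀ (W₀ : WeierstrassCurve ℚ) [W₀.IsElliptic] [W₀.IsGloballyMinimal],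
      (∀ n : ℕ, W₀.HasSurjectiveModNGaloisRep (3 ^ n : ℕ)) → Finite W₀.sha →
      ∀ {N : ℕ} [NeZero N], N = W₀.conductorNorm ℤ →
      ∀ (D₀ : ModularParametrizationData W₀ N),
        (∀ z ∈ D₀.L.lattice, ∃ w ∈ periodLattice D₀.f, z = D₀.c * w) →
        (∀ (W₂ : WeierstrassCurve ℚ) [W₂.IsElliptic] (D₂ : ModularParametrizationData W₂ N),
          D₂.f = D₀.f → D₀.modularDegree ≤ D₂.modularDegree) →
        (∀ r : ℚ, ratPlusSymbol D₀.f r ≠ 0 → 0 ≤ padicValRat 3 (ratPlusSymbol D₀.f r)) →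
        kuriharaVanishingOrder W₀ 3 D₀.f = 0 →
        ¬ (haveI : Fact (Nat.Prime 3) := ⟨Nat.prime_three⟩; Addv W₀ 3) →
        W₀.HasMultiplicativeReductionAtPrime 3 →
        (haveI : Fact (Nat.Prime 3) := ⟨Nat.prime_three⟩; Ram W₀ 3) →
        ∀ m : ℕ, padicValNat 3 W₀.tamagawaProduct ≤ m →
        ∀ (q : ℕ), q ∣ W₀.conductorNorm ℤ * 3 → ∀ (u : ZMod (3 ^ m)) (φ : ℚ → ZMod (3 ^ m)),
          (∀ x, φ (x + 1) = φ x) →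
          (∀ ℓ : ℕ, ℓ.Prime → ¬ ℓ ∣ W₀.conductorNorm ℤ * 3 → ∀ x : ℚ,
            (W₀.frobeniusTrace ℓ : ZMod (3 ^ m)) * φ x = (∑ j : Fin ℓ, φ ((x + j) / ℓ)) + φ (ℓ * x)) →
          (∀ x : ℚ, ratModP (3 ^ m) (ratPlusSymbol D₀.f x) = u * (φ x - φ (q * x))) →
        ∃ d : ℕ, kuriharaPartialDeepInfty W₀ 3 D₀.f = d ∧
          kuriharaPartial W₀ 3 D₀.f 0 ≤
            ((padicValNat 3 (Nat.card (AddCommGroup.primaryComponent W₀.sha 3)) + d : ℕ) : ℕ∞) := by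
  intro W₀ _ _ htow hfin N _ hN D₀ hopt _ hint hord hna hmult hram m hv q hq u φ hperφ hφH hC
  haveI : Fact (Nat.Prime 3) := ⟨Nat.prime_three⟩
  exact deepLowerAtThree_row_mult_of_skinner_of_tamagawa_le_deepInfty hSk hmod hGZK W₀ htow hfin
    D₀.f D₀.isNewformOf hint hord hmult hram
    (periodTransfer_three_of_optimal_of_not_addv W₀ hMaz hN D₀ hopt hna)
    (tamagawa_le_kuriharaPartialInfty_of_stabilisedCongruence W₀ 3 m D₀.f hint hv q hq u φ hperφ hφH hC).2

end Rows

end Summit.BirchSwinnertonDyer.BirchSwinnertonDyer.Theorems.KimAtThreeDeepLowerTamagawaLevelLowering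

end
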